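import Literature.NumberTheory.GelbartRogawski1991.LocalDoubledUnitaryDatum
import HarnessLib

-- buildfix G11b-3 recipe (LEDGER B13-1/B13-3): elaborate sequentially so the trailing `attribute [implicit_reducible]`
-- block (reducibilityCoreExt is keyed to the async environment branch) is in force at `.olean` export.
set_option Elab.async false

/-!
# An integral isometry of `𝕎^𝔻_v` carrying `ℓ_Y = 0 × Y` onto Kudla's Lagrangian `ℓ_Δ = Res Δ`

Topic `NumberTheory/GelbartRogawski1991`; namespace `Literature.NumberTheory.GelbartRogawski1991.UnitaryDualPair.LocalSplitting`
(that of `LocalDoubledUnitaryDatum.lean`). KERNEL mathematics only (theorems; no definition, no named fact, no `axiom`,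
no `sorry`).

For the doubled datum `T^𝔻 = T₀ ⊕ (−T₀)` (`T₀` symmetric) at a finite place `v` with `2 ∈ 𝒪_v^×` there is an element
`δ_Δ ∈ Sp(𝕎^𝔻_v)` which (i) maps the standard Lagrangian `ℓ_Y = 0 × F_v^{n+n}` onto `ℓ_Δ = Res Δ`
(`deltaLagrangian`) and (ii) preserves the lattice `𝒪_v^{n+n} × 𝒪_v^{n+n}`
(`exists_integral_isometry_map_lagrangianY_eq_deltaLagrangian`). Explicitly (halves `L`, `R` of each coordinate vector,
`h = ½`): `δ_Δ(a, b) = (x, y)` with `x_L = h(a_L − a_R) + h(b_L − b_R)`, `x_R = −h(a_L − a_R) + h(b_L − b_R)`,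
`y_L = −h(a_L + a_R) + h(b_L + b_R)`, `y_R = h(a_L + a_R) + h(b_L + b_R)`: it maps `X = F^N × 0` onto the Lagrangian
`{x_R = −x_L, y_R = −y_L} = Res ∇` (`∇` the antidiagonal) and `0 × Y` onto `Res Δ`, and
`A_{T^𝔻}(δ_Δ w, δ_Δ w') = A_{T^𝔻}(w, w')` is the identity `key_identity` (which uses `ᵗT₀ = T₀` and `4h² = 1`).  This is the
standard "Cayley" change of polarisation `𝕎 ⊕ 𝕎⁻ = Δ ⊕ ∇` of the doubling method ([Kudla1994] §2, [HarrisKudlaSweet1996]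
§1 (1.11)); its integrality at `v ∤ 2` is what makes the unramified computation of [GelbartRogawski1991] §3.1 (3.1.3)
run on `P_Δ(𝒪_v)` (consumed with `RepresentationTheory/HeisenbergGroup/LeraySectionUnramifiedParabolic`).
Written for GR-1's stub `L7` (unramified clause) of the local splitting skeleton (stage-1 cell `pub-hodgecm`); nothing
here is a claim of the manuscripts adjudicated there.

## References

* S. S. Kudla, Israel J. Math. 87 (1994) 361–401, §2 (the polarisation `𝕎 = Δ + ∇` of the doubled space) [Kudla1994].
* M. Harris, S. S. Kudla, W. J. Sweet, J. Amer. Math. Soc. 9 (1996) 941–1004, §1 (1.11) [HarrisKudlaSweet1996].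
* S. Gelbart, J. Rogawski, Invent. Math. 105 (1991), §3.1 (3.1.3), p. 456 [GelbartRogawski1991].
-/

set_option autoImplicit false

noncomputable section

open NumberField IsDedekindDomain MeasureTheory Matrix
open Literature.RepresentationTheory.HeisenbergGroup
open Literature.NumberTheory.Automorphic Literature.NumberTheory.Weil1964

namespace Literature.NumberTheory.GelbartRogawski1991.UnitaryDualPair.LocalSplitting

/-! ## §1 Algebra: halves, `Fin.append`, and the symplectic identity -/

section Algebra

variable {K : Type*} [Field K] {n : ℕ}

/-- `Fin.append` is additive. [folklore] -/
private theorem append_add (p p' q q' : Fin n → K) :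
    Fin.append (p + p') (q + q') = Fin.append p q + Fin.append p' q' := by
  funext k
  refine Fin.addCases (fun i => ?_) (fun i => ?_) k
  · simp only [Fin.append_left, Pi.add_apply]
  · simp only [Fin.append_right, Pi.add_apply]

/-- `Fin.append` is homogeneous. [folklore] -/
private theorem append_smul (c : K) (p q : Fin n → K) : Fin.append (c • p) (c • q) = c • Fin.append p q := by
  funext k
  refine Fin.addCases (fun i => ?_) (fun i => ?_) k
  · simp only [Fin.append_left, Pi.smul_apply]
  · simp only [Fin.append_right, Pi.smul_apply]

/-- `⟨x, S y⟩ = ⟨y, S x⟩` for `S` symmetric. [folklore] -/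
private theorem dotProduct_mulVec_comm {S : Matrix (Fin n) (Fin n) K} (hS : S.IsSymm) (x y : Fin n → K) :
    x ⬝ᵥ (S *ᵥ y) = y ⬝ᵥ (S *ᵥ x) := by
  rw [dotProduct_mulVec, ← mulVec_transpose, hS.eq, dotProduct_comm]

/-- **the symplectic identity of `δ_Δ`**: with `h = ½` (`2h = 1`) and `S` symmetric,
`A(δ_Δ w, δ_Δ w') = A(w, w')` written out in the eight half-vectors. [cite: Kudla1994, §2; HarrisKudlaSweet1996, §1 (1.11)] -/
private theorem key_identity {S : Matrix (Fin n) (Fin n) K} (hS : S.IsSymm) (h : K) (h2 : 2 * h = 1)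
    (aL aR bL bR aL' aR' bL' bR' : Fin n → K) :
    ((h • (aL - aR) + h • (bL - bR)) ⬝ᵥ (S *ᵥ (-(h • (aL' + aR')) + h • (bL' + bR'))) -
        (-(h • (aL - aR)) + h • (bL - bR)) ⬝ᵥ (S *ᵥ (h • (aL' + aR') + h • (bL' + bR')))) -
      ((h • (aL' - aR') + h • (bL' - bR')) ⬝ᵥ (S *ᵥ (-(h • (aL + aR)) + h • (bL + bR))) -
        (-(h • (aL' - aR')) + h • (bL' - bR')) ⬝ᵥ (S *ᵥ (h • (aL + aR) + h • (bL + bR)))) =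
      (aL ⬝ᵥ (S *ᵥ bL') - aR ⬝ᵥ (S *ᵥ bR')) - (aL' ⬝ᵥ (S *ᵥ bL) - aR' ⬝ᵥ (S *ᵥ bR)) := by
  simp only [dotProduct_add, dotProduct_neg, dotProduct_smul, add_dotProduct, sub_dotProduct, neg_dotProduct,
    smul_dotProduct, Matrix.mulVec_add, Matrix.mulVec_neg, Matrix.mulVec_smul, smul_eq_mul]
  linear_combination ((2 * h + 1) * ((aL ⬝ᵥ (S *ᵥ bL') - aR ⬝ᵥ (S *ᵥ bR')) - (aL' ⬝ᵥ (S *ᵥ bL) - aR' ⬝ᵥ (S *ᵥ bR)))) * h2 +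
    (2 * h ^ 2) * (dotProduct_mulVec_comm hS bL' aL + dotProduct_mulVec_comm hS bL' aR -
      dotProduct_mulVec_comm hS bR' aL - dotProduct_mulVec_comm hS bR' aR - dotProduct_mulVec_comm hS bL aL' -
      dotProduct_mulVec_comm hS bL aR' + dotProduct_mulVec_comm hS bR aL' + dotProduct_mulVec_comm hS bR aR')

end Algebra

/-! ## §2 The element `δ_Δ` at a finite place -/

section Place

variable (F : Type) [Field F] [NumberField F] (v : HeightOneSpectrum (𝓞 F)) (n : ℕ) (T₀ : Matrix (Fin n) (Fin n) F)

/-- `(Fin.append p q)_L = p`. [folklore] -/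
private theorem halfL_append (p q : Fin n → v.adicCompletion F) : halfL F v n (Fin.append p q) = p := by
  funext i
  show Fin.append p q (e₂ n (Sum.inl i)) = p i
  rw [finSumFinEquiv_apply_left, Fin.append_left]

/-- `(Fin.append p q)_R = q`. [folklore] -/
private theorem halfR_append (p q : Fin n → v.adicCompletion F) : halfR F v n (Fin.append p q) = q := by
  funext i
  show Fin.append p q (e₂ n (Sum.inr i)) = q i
  rw [finSumFinEquiv_apply_right, Fin.append_right]

/-- `x = Fin.append x_L x_R`. [folklore] -/
private theorem append_halfL_halfR (x : Fin (n + n) → v.adicCompletion F) :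
    Fin.append (halfL F v n x) (halfR F v n x) = x := by
  funext k
  refine Fin.addCases (fun i => ?_) (fun i => ?_) k
  · rw [Fin.append_left]; show x (e₂ n (Sum.inl i)) = _; rw [finSumFinEquiv_apply_left]
  · rw [Fin.append_right]; show x (e₂ n (Sum.inr i)) = _; rw [finSumFinEquiv_apply_right]

/-- halves of an integral vector are integral. [folklore] -/
private theorem halfL_mem {x : Fin (n + n) → v.adicCompletion F}
    (hx : x ∈ piPrimePowBall (v.adicCompletion F) (Fin (n + n)) 0) :
    halfL F v n x ∈ piPrimePowBall (v.adicCompletion F) (Fin n) 0 :=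
  mem_piPrimePowBall_iff.2 fun _ => mem_piPrimePowBall_iff.1 hx _

/-- halves of an integral vector are integral. [folklore] -/
private theorem halfR_mem {x : Fin (n + n) → v.adicCompletion F}
    (hx : x ∈ piPrimePowBall (v.adicCompletion F) (Fin (n + n)) 0) :
    halfR F v n x ∈ piPrimePowBall (v.adicCompletion F) (Fin n) 0 :=
  mem_piPrimePowBall_iff.2 fun _ => mem_piPrimePowBall_iff.1 hx _

/-- a vector on `Fin (n + n)` is determined by its halves. [folklore] -/
private theorem eq_of_halfL_halfR {x y : Fin (n + n) → v.adicCompletion F} (hL : halfL F v n x = halfL F v n y)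
    (hR : halfR F v n x = halfR F v n y) : x = y := by
  rw [← append_halfL_halfR F v n x, ← append_halfL_halfR F v n y, hL, hR]

/-- differences of integral vectors are integral. [folklore] -/
private theorem sub_mem' {m : ℕ} {x y : Fin m → v.adicCompletion F}
    (hx : x ∈ piPrimePowBall (v.adicCompletion F) (Fin m) 0) (hy : y ∈ piPrimePowBall (v.adicCompletion F) (Fin m) 0) :
    x - y ∈ piPrimePowBall (v.adicCompletion F) (Fin m) 0 := by
  rw [sub_eq_add_neg]; exact add_mem_piPrimePowBall hx (neg_mem_piPrimePowBall hy)

/-- `Fin.append` of integral vectors is integral. [folklore] -/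
private theorem append_mem {p q : Fin n → v.adicCompletion F} (hp : p ∈ piPrimePowBall (v.adicCompletion F) (Fin n) 0)
    (hq : q ∈ piPrimePowBall (v.adicCompletion F) (Fin n) 0) :
    Fin.append p q ∈ piPrimePowBall (v.adicCompletion F) (Fin (n + n)) 0 :=
  mem_piPrimePowBall_iff.2 fun k => by
    refine Fin.addCases (fun i => ?_) (fun i => ?_) k
    · rw [Fin.append_left]; exact mem_piPrimePowBall_iff.1 hp i
    · rw [Fin.append_right]; exact mem_piPrimePowBall_iff.1 hq i

/-- `h • u` is integral for `h ∈ 𝒪`, `u` integral. [folklore] -/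
private theorem smul_mem {c : v.adicCompletion F} (hc : c ∈ primePowBall (v.adicCompletion F) 0)
    {u : Fin n → v.adicCompletion F} (hu : u ∈ piPrimePowBall (v.adicCompletion F) (Fin n) 0) :
    c • u ∈ piPrimePowBall (v.adicCompletion F) (Fin n) 0 :=
  mem_piPrimePowBall_iff.2 fun i => by
    have hm := mul_mem_primePowBall hc (mem_piPrimePowBall_iff.1 hu i)
    rwa [add_zero] at hm

/-- **AN INTEGRAL ISOMETRY `δ_Δ ∈ Sp(𝕎^𝔻_v)` WITH `δ_Δ ℓ_Y = ℓ_Δ`** (`T₀` symmetric, `½ ∈ 𝒪_v`): there is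
`δ ∈ Sp(𝕎^𝔻_v)` preserving `𝒪_v^{n+n} × 𝒪_v^{n+n}` with `δ(0 × F_v^{n+n}) = Res Δ` — the Cayley change of
polarisation `X ⊕ Y ↝ ∇ ⊕ Δ` of the doubled space. [cite: Kudla1994, §2; HarrisKudlaSweet1996, §1 (1.11); GelbartRogawski1991, §3.1 (3.1.3), p. 456] -/
theorem exists_integral_isometry_map_lagrangianY_eq_deltaLagrangian (hT₀ : T₀.IsSymm)
    (h2 : (⅟(2 : v.adicCompletion F)) ∈ primePowBall (v.adicCompletion F) 0) :
    ∃ δ : LocalSp F (n + n) (gramD F n T₀) v,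
      (∀ p ∈ (piPrimePowBall (v.adicCompletion F) (Fin (n + n)) 0) ×ˢ (piPrimePowBall (v.adicCompletion F) (Fin (n + n)) 0),
          (δ : ((Fin (n + n) → v.adicCompletion F) × (Fin (n + n) → v.adicCompletion F)) ≃ₗ[v.adicCompletion F] ((Fin (n + n) → v.adicCompletion F) × (Fin (n + n) → v.adicCompletion F))) p ∈ (piPrimePowBall (v.adicCompletion F) (Fin (n + n)) 0) ×ˢ (piPrimePowBall (v.adicCompletion F) (Fin (n + n)) 0)) ∧
        Submodule.map (toLin F v δ) (lagrangianY F (n + n) v) = deltaLagrangian F v n := by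
  have h22 : (2 : v.adicCompletion F) * ⅟(2 : v.adicCompletion F) = 1 := mul_invOf_self _
  -- the forward and backward maps
  obtain ⟨f, hf⟩ : ∃ f : ((Fin (n + n) → v.adicCompletion F) × (Fin (n + n) → v.adicCompletion F)) →ₗ[v.adicCompletion F] ((Fin (n + n) → v.adicCompletion F) × (Fin (n + n) → v.adicCompletion F)), ∀ p, f p = (Fin.append (⅟(2 : v.adicCompletion F) • (halfL F v n p.1 - halfR F v n p.1) + ⅟(2 : v.adicCompletion F) • (halfL F v n p.2 - halfR F v n p.2)) (-(⅟(2 : v.adicCompletion F) • (halfL F v n p.1 - halfR F v n p.1)) + ⅟(2 : v.adicCompletion F) • (halfL F v n p.2 - halfR F v n p.2)), Fin.append (-(⅟(2 : v.adicCompletion F) • (halfL F v n p.1 + halfR F v n p.1)) + ⅟(2 : v.adicCompletion F) • (halfL F v n p.2 + halfR F v n p.2)) (⅟(2 : v.adicCompletion F) • (halfL F v n p.1 + halfR F v n p.1) + ⅟(2 : v.adicCompletion F) • (halfL F v n p.2 + halfR F v n p.2))) := by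
    refine ⟨{ toFun := fun p => (Fin.append (⅟(2 : v.adicCompletion F) • (halfL F v n p.1 - halfR F v n p.1) + ⅟(2 : v.adicCompletion F) • (halfL F v n p.2 - halfR F v n p.2)) (-(⅟(2 : v.adicCompletion F) • (halfL F v n p.1 - halfR F v n p.1)) + ⅟(2 : v.adicCompletion F) • (halfL F v n p.2 - halfR F v n p.2)), Fin.append (-(⅟(2 : v.adicCompletion F) • (halfL F v n p.1 + halfR F v n p.1)) + ⅟(2 : v.adicCompletion F) • (halfL F v n p.2 + halfR F v n p.2)) (⅟(2 : v.adicCompletion F) • (halfL F v n p.1 + halfR F v n p.1) + ⅟(2 : v.adicCompletion F) • (halfL F v n p.2 + halfR F v n p.2))), map_add' := fun p p' => ?_, map_smul' := fun c p => ?_ }, fun p => rfl⟩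
    · simp only [Prod.fst_add, Prod.snd_add, Prod.mk_add_mk, ← append_add]
      congr 1 <;> congr 1 <;> (funext i; simp only [halfL, halfR, Pi.add_apply, Pi.smul_apply, Pi.sub_apply,
        Pi.neg_apply, smul_eq_mul]; ring)
    · simp only [Prod.smul_fst, Prod.smul_snd, Prod.smul_mk, RingHom.id_apply, ← append_smul]
      congr 1 <;> congr 1 <;> (funext i; simp only [halfL, halfR, Pi.add_apply, Pi.smul_apply, Pi.sub_apply,
        Pi.neg_apply, smul_eq_mul]; ring)
  obtain ⟨g, hg⟩ : ∃ g : ((Fin (n + n) → v.adicCompletion F) × (Fin (n + n) → v.adicCompletion F)) →ₗ[v.adicCompletion F] ((Fin (n + n) → v.adicCompletion F) × (Fin (n + n) → v.adicCompletion F)), ∀ p, g p = (Fin.append (⅟(2 : v.adicCompletion F) • ((halfL F v n p.1 - halfR F v n p.1) + (halfR F v n p.2 - halfL F v n p.2))) (⅟(2 : v.adicCompletion F) • ((halfR F v n p.2 - halfL F v n p.2) - (halfL F v n p.1 - halfR F v n p.1))), Fin.append (⅟(2 : v.adicCompletion F) • ((halfL F v n p.1 + halfR F v n p.1) + (halfL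 F v n p.2 + halfR F v n p.2))) (⅟(2 : v.adicCompletion F) • ((halfL F v n p.2 + halfR F v n p.2) - (halfL F v n p.1 + halfR F v n p.1)))) := by
    refine ⟨{ toFun := fun p => (Fin.append (⅟(2 : v.adicCompletion F) • ((halfL F v n p.1 - halfR F v n p.1) + (halfR F v n p.2 - halfL F v n p.2))) (⅟(2 : v.adicCompletion F) • ((halfR F v n p.2 - halfL F v n p.2) - (halfL F v n p.1 - halfR F v n p.1))), Fin.append (⅟(2 : v.adicCompletion F) • ((halfL F v n p.1 + halfR F v n p.1) + (halfL F v n p.2 + halfR F v n p.2))) (⅟(2 : v.adicCompletion F) • ((halfL F v n p.2 + halfR F v n p.2) - (halfL F v n p.1 + halfR F v n p.1)))), map_add' := fun p p' => ?_, map_smul' := fun c p => ?_ }, fun p => rfl⟩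
    · simp only [Prod.fst_add, Prod.snd_add, Prod.mk_add_mk, ← append_add]
      congr 1 <;> congr 1 <;>
        (funext i; simp only [halfL, halfR, Pi.add_apply, Pi.smul_apply, Pi.sub_apply, smul_eq_mul]; ring)
    · simp only [Prod.smul_fst, Prod.smul_snd, Prod.smul_mk, RingHom.id_apply, ← append_smul]
      congr 1 <;> congr 1 <;>
        (funext i; simp only [halfL, halfR, Pi.add_apply, Pi.smul_apply, Pi.sub_apply, smul_eq_mul]; ring)
  -- halves of the images
  have hf1L : ∀ p, halfL F v n (f p).1 = (⅟(2 : v.adicCompletion F) • (halfL F v n p.1 - halfR F v n p.1) + ⅟(2 : v.adicCompletion F) • (halfL F v n p.2 - halfR F v n p.2)) := fun p => by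
    rw [hf]; exact halfL_append F v n _ _
  have hf1R : ∀ p, halfR F v n (f p).1 = (-(⅟(2 : v.adicCompletion F) • (halfL F v n p.1 - halfR F v n p.1)) + ⅟(2 : v.adicCompletion F) • (halfL F v n p.2 - halfR F v n p.2)) := fun p => by
    rw [hf]; exact halfR_append F v n _ _
  have hf2L : ∀ p, halfL F v n (f p).2 = (-(⅟(2 : v.adicCompletion F) • (halfL F v n p.1 + halfR F v n p.1)) + ⅟(2 : v.adicCompletion F) • (halfL F v n p.2 + halfR F v n p.2)) := fun p => by
    rw [hf]; exact halfL_append F v n _ _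
  have hf2R : ∀ p, halfR F v n (f p).2 = (⅟(2 : v.adicCompletion F) • (halfL F v n p.1 + halfR F v n p.1) + ⅟(2 : v.adicCompletion F) • (halfL F v n p.2 + halfR F v n p.2)) := fun p => by
    rw [hf]; exact halfR_append F v n _ _
  have hg1L : ∀ p, halfL F v n (g p).1 = (⅟(2 : v.adicCompletion F) • ((halfL F v n p.1 - halfR F v n p.1) + (halfR F v n p.2 - halfL F v n p.2))) := fun p => by
    rw [hg]; exact halfL_append F v n _ _
  have hg1R : ∀ p, halfR F v n (g p).1 = (⅟(2 : v.adicCompletion F) • ((halfR F v n p.2 - halfL F v n p.2) - (halfL F v n p.1 - halfR F v n p.1))) := fun p => by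
    rw [hg]; exact halfR_append F v n _ _
  have hg2L : ∀ p, halfL F v n (g p).2 = (⅟(2 : v.adicCompletion F) • ((halfL F v n p.1 + halfR F v n p.1) + (halfL F v n p.2 + halfR F v n p.2))) := fun p => by
    rw [hg]; exact halfL_append F v n _ _
  have hg2R : ∀ p, halfR F v n (g p).2 = (⅟(2 : v.adicCompletion F) • ((halfL F v n p.2 + halfR F v n p.2) - (halfL F v n p.1 + halfR F v n p.1))) := fun p => by
    rw [hg]; exact halfR_append F v n _ _
  -- `f ∘ g = id = g ∘ f`
  have h20 : (2 : v.adicCompletion F) ≠ 0 := Invertible.ne_zero 2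
  have hfg : ∀ p, f (g p) = p := fun p => by
    rw [hf (g p), hg1L, hg1R, hg2L, hg2R]
    refine Prod.ext (eq_of_halfL_halfR F v n ?_ ?_) (eq_of_halfL_halfR F v n ?_ ?_)
    · rw [halfL_append]
      (funext i; simp only [Pi.add_apply, Pi.sub_apply, Pi.smul_apply, smul_eq_mul, invOf_eq_inv];
        field_simp; ring)
    · rw [halfR_append]
      (funext i; simp only [Pi.add_apply, Pi.sub_apply, Pi.neg_apply, Pi.smul_apply, smul_eq_mul, invOf_eq_inv];
        field_simp; ring)
    · rw [halfL_append]
      (funext i; simp only [Pi.add_apply, Pi.sub_apply, Pi.neg_apply, Pi.smul_apply, smul_eq_mul, invOf_eq_inv];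
        field_simp; ring)
    · rw [halfR_append]
      (funext i; simp only [Pi.add_apply, Pi.sub_apply, Pi.smul_apply, smul_eq_mul, invOf_eq_inv];
        field_simp; ring)
  have hgf : ∀ p, g (f p) = p := fun p => by
    rw [hg (f p), hf1L, hf1R, hf2L, hf2R]
    refine Prod.ext (eq_of_halfL_halfR F v n ?_ ?_) (eq_of_halfL_halfR F v n ?_ ?_)
    · rw [halfL_append]
      (funext i; simp only [Pi.add_apply, Pi.sub_apply, Pi.neg_apply, Pi.smul_apply, smul_eq_mul, invOf_eq_inv];
        field_simp; ring)
    · rw [halfR_append]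
      (funext i; simp only [Pi.add_apply, Pi.sub_apply, Pi.neg_apply, Pi.smul_apply, smul_eq_mul, invOf_eq_inv];
        field_simp; ring)
    · rw [halfL_append]
      (funext i; simp only [Pi.add_apply, Pi.sub_apply, Pi.neg_apply, Pi.smul_apply, smul_eq_mul, invOf_eq_inv];
        field_simp; ring)
    · rw [halfR_append]
      (funext i; simp only [Pi.add_apply, Pi.sub_apply, Pi.neg_apply, Pi.smul_apply, smul_eq_mul, invOf_eq_inv];
        field_simp; ring)
  -- `δ_Δ` is an isometry of `A_{T^𝔻}`
  have hmem : LinearEquiv.ofLinear f g (LinearMap.ext hfg) (LinearMap.ext hgf) ∈ LocalSp F (n + n) (gramD F n T₀) v := by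
    refine (mem_symplecticGroup _ _).2 fun w w' => ?_
    simp only [LinearEquiv.ofLinear_apply, polar_apply, localPairing_gramD, hf1L, hf1R, hf2L, hf2R]
    exact key_identity (hT₀.map _) _ h22 _ _ _ _ _ _ _ _
  refine ⟨⟨LinearEquiv.ofLinear f g (LinearMap.ext hfg) (LinearMap.ext hgf), hmem⟩, fun p hp => ?_, ?_⟩
  · -- integrality
    change f p ∈ _
    rw [hf]
    have h1 := (Set.mem_prod.1 hp).1
    have h2' := (Set.mem_prod.1 hp).2
    have haL := halfL_mem F v n h1
    have haR := halfR_mem F v n h1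
    have hbL := halfL_mem F v n h2'
    have hbR := halfR_mem F v n h2'
    exact Set.mk_mem_prod
      (append_mem F v n (add_mem_piPrimePowBall (smul_mem F v n h2 (sub_mem' F v haL haR))
          (smul_mem F v n h2 (sub_mem' F v hbL hbR)))
        (add_mem_piPrimePowBall (neg_mem_piPrimePowBall (smul_mem F v n h2 (sub_mem' F v haL haR)))
          (smul_mem F v n h2 (sub_mem' F v hbL hbR))))
      (append_mem F v n (add_mem_piPrimePowBall (neg_mem_piPrimePowBall (smul_mem F v n h2 (add_mem_piPrimePowBall haL haR)))
          (smul_mem F v n h2 (add_mem_piPrimePowBall hbL hbR)))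
        (add_mem_piPrimePowBall (smul_mem F v n h2 (add_mem_piPrimePowBall haL haR))
          (smul_mem F v n h2 (add_mem_piPrimePowBall hbL hbR))))
  · -- `δ_Δ ℓ_Y = ℓ_Δ`
    ext m
    simp only [lagrangianY, Submodule.mem_map, Submodule.mem_prod, Submodule.mem_bot, Submodule.mem_top, and_true]
    constructor
    · rintro ⟨q, hq, rfl⟩
      change f q ∈ deltaLagrangian F v n
      rw [mem_deltaLagrangian_iff, hf1L, hf1R, hf2L, hf2R, hq]
      refine ⟨?_, ?_⟩
      · funext i
        simp only [Pi.add_apply, Pi.sub_apply, Pi.neg_apply, Pi.smul_apply, smul_eq_mul]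
        show ⅟(2 : v.adicCompletion F) * (halfL F v n (0 : Fin (n + n) → v.adicCompletion F) i - halfR F v n (0 : Fin (n + n) → v.adicCompletion F) i) + _ = _
        simp only [halfL, halfR, Pi.zero_apply, sub_self, mul_zero, neg_zero]
      · funext i
        simp only [Pi.add_apply, Pi.neg_apply, Pi.smul_apply, smul_eq_mul]
        show -(⅟(2 : v.adicCompletion F) * (halfL F v n (0 : Fin (n + n) → v.adicCompletion F) i + halfR F v n (0 : Fin (n + n) → v.adicCompletion F) i)) + _ = _
        simp only [halfL, halfR, Pi.zero_apply, add_zero, mul_zero, neg_zero]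
    · intro hm
      rw [mem_deltaLagrangian_iff] at hm
      refine ⟨g m, ?_, ?_⟩
      · rw [hg]
        refine eq_of_halfL_halfR F v n ?_ ?_
        · rw [halfL_append, hm.1, hm.2, sub_self, sub_self, add_zero, smul_zero]; rfl
        · rw [halfR_append, hm.1, hm.2, sub_self, sub_self, sub_zero, smul_zero]; rfl
      · change f (g m) = m
        exact hfg m

end Place

/-! ### Build-lane note (ops-buildfix G11b-3 recipe, LEDGER B13-1, 2026-08-21)
`lean -o` (the hub build lane, never `lean`/the gate check) runs Lean 4.32's library-suggestion indexers
(`Lean.LibrarySuggestions.SymbolFrequency` / `SineQuaNon`, from their `exportEntriesFn`) over the statement of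
every local theorem that is not a denied premise; on this family's statements (very large dependent binder
telescopes through the theta-kernel / dual-pair data) that fold runs for tens of minutes to hours and the build
lane kills the job (incident G11b-3, run/shared/lean/ops/buildfix/G11b-3-DOSSIER.md). `isDeniedPremise` skips
`[implicit_reducible]` constants before any fold, and a reducibility status on a *theorem* is inert (Meta never
unfolds `thmInfo`; the kernel ignores the attribute), so the public theorems of this file are tagged
`[implicit_reducible]` purely to keep them out of that index. Only other effect: they are not offered by
`+suggestions` premise selectors. No statement or proof is changed; superseded if the operator lands a
deny-list form (`HarnessLib.PremiseIndex`). -/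
set_option allowUnsafeReducibility true in
attribute [implicit_reducible]
  exists_integral_isometry_map_lagrangianY_eq_deltaLagrangian

end Literature.NumberTheory.GelbartRogawski1991.UnitaryDualPair.LocalSplitting

end
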